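import Literature.Computability.Cryptography.ShorPerfectPower
import Literature.Computability.Complexity.BrickAlgebra
import Literature.Computability.Complexity.StackBricksArith
import Literature.Computability.Complexity.BinarySubtraction
import HarnessLib

/-!
# Perfect-power detection in `FP` by the brick algebra: `m ↦ ⟨[ppBase m < m], ppBase m⟩`

Family `PQC`; companion of `ShorPerfectPower.lean` (the digit-by-digit integer root `rootScan`,
the largest exponent `ppExp`, `ppBase_eq_nthRoot`) on the way to the programming fact
`Shor1997.shorComp_isPolyTime`. The perfect-power branch of Shor's splitting attempt needs, in
polynomial time, whether `m` is a nontrivial perfect power and if so its least root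
`Shor1997.ppBase m`. Here this is assembled **in the `FP`-algebra of `BrickAlgebra.lean`** —
counted loops (`loopStep`, `loopFn_mem_FP`, `iterate_loopStep`), projections, one-bit
branches — over the arithmetic bricks `addFn`, `prodFn`, `ltFn`, `subFn` (no new machine):

* `idF`, `succF`, `lenBinF v = encodeNat |v|`, `pow2F ⟨v, j⟩ = encodeNat 2^⟦j⟧` (`⟦j⟧ ≤ |v|`);
* `powAccF ⟨v, ⟨c, k⟩⟩` — the capped power accumulator (multiply by `c`, `⟦k⟧` times, freezing
  once above `⟦v⟧`), with `powLeF` / `powEqF` deciding `⟦c⟧^⟦k⟧ ≤ ⟦v⟧` / `= ⟦v⟧` (`powAcc_spec`);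
* `rootF ⟨v, k⟩ = encodeNat (Nat.nthRoot ⟦k⟧ ⟦v⟧)` for `1 ≤ ⟦k⟧ ≤ |v|` (the scan `rootScan`);
* `ppF m = ⟨[decide (ppBase ⟦m⟧ < ⟦m⟧)], …⟩` with second field `encodeNat (ppBase ⟦m⟧)` when the
  bit is set, for canonical `m` with `⟦m⟧ ≥ 2` (`ppF_spec`), and **`ppF_mem_FP`**.

All loops run `|first field|` rounds (`Polynomial.X`), which is why every function carries the
long operand `v` as context.

## References

* H. Cohen, *A Course in Computational Algebraic Number Theory*, GTM 138, Springer 1993, §1.7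
  (integer roots; power detection by `k`-th roots for `k ≤ lg n`).
* S. Arora, B. Barak, *Computational Complexity: A Modern Approach*, CUP 2009, §1.3.
-/

noncomputable section

namespace Literature.Computability.Cryptography

namespace ShorFP

open _root_.Computability Polynomial Complexity Complexity.Brick

/-! ### Identity, successor, predecessor -/

/-- The identity string function. (`CookReducibilityTransitive.lean` proves the same fact as
`OracleCompose.id_mem_FP` inside the oracle-composition development; this is the lightweight
copy for the brick algebra.) [folklore] -/
def idF : List Bool → List Bool := fun z => z

/-- `idF ∈ FP` (the empty stack program). [folklore] -/
theorem idF_mem_FP : idF ∈ FP :=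
  unOp_mem_FP Com.skip AReg.x AReg.x idF (fun _ => 0) Polynomial.X (by simp) (by simp [idF])
    (fun a => ⟨_, Com.Runs.skip _, by simp [init1, idF]⟩)

/-- `succF w = encodeNat (⟦w⟧ + 1)`. [folklore] -/
def succF : List Bool → List Bool := addFn ∘ fanoutFn idF (fun _ => [true])

/-- Value of `succF`. [folklore] -/
@[simp] theorem succF_apply (w : List Bool) : succF w = encodeNat (bitsToNat w + 1) := by
  simp [succF, idF]

/-- `succF ∈ FP`. [folklore] -/
theorem succF_mem_FP : succF ∈ FP := comp_mem_FP addFn_mem_FP (fanoutFn_mem_FP idF_mem_FP (const_mem_FP _))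

/-- `predF w = encodeNat (⟦w⟧ - 1)`. [folklore] -/
def predF : List Bool → List Bool := subFn ∘ fanoutFn idF (fun _ => [true])

/-- Value of `predF`. [folklore] -/
@[simp] theorem predF_apply (w : List Bool) : predF w = encodeNat (bitsToNat w - 1) := by
  simp [predF, idF]

/-- `predF ∈ FP`. [folklore] -/
theorem predF_mem_FP : predF ∈ FP := comp_mem_FP subFn_mem_FP (fanoutFn_mem_FP idF_mem_FP (const_mem_FP _))

/-! ### The length of a string as a numeral -/

/-- One round of the length count: keep the string, bump the numeral. [folklore] -/
def lenStep : List Bool → List Bool := fanoutFn fstF (succF ∘ sndF)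

/-- `lenBinF v = encodeNat |v|`: count `|v|` rounds (`Polynomial.X` rounds of `lenStep` from
`⟨v, 0⟩`). [folklore] -/
def lenBinF : List Bool → List Bool :=
  sndF ∘ (fun z => lenStep^[(X : Polynomial ℕ).eval (fstF z).length] z) ∘ fanoutFn idF (fun _ => [])

/-- Rounds of the length count. [folklore] -/
theorem iterate_lenStep (v : List Bool) : ∀ (n j : ℕ), lenStep^[n] (boolPair v (encodeNat j)) = boolPair v (encodeNat (j + n))
  | 0, j => rfl
  | n + 1, j => by
    rw [Function.iterate_succ_apply, show lenStep (boolPair v (encodeNat j)) = boolPair v (encodeNat (j + 1)) by simp [lenStep],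
      iterate_lenStep v n (j + 1)]
    congr 2; omega

/-- **`lenBinF v = encodeNat |v|`.** [folklore] -/
@[simp] theorem lenBinF_apply (v : List Bool) : lenBinF v = encodeNat v.length := by
  have h := iterate_lenStep v v.length 0
  simp only [Nat.zero_add, show encodeNat 0 = [] from rfl] at h
  unfold lenBinF
  simp only [Function.comp_apply, fanoutFn_apply, idF, fstF_boolPair, eval_X]
  rw [h, sndF_boolPair]

/-- `lenBinF ∈ FP`. [folklore] -/
theorem lenBinF_mem_FP : lenBinF ∈ FP := by
  refine comp_mem_FP sndF_mem_FP (comp_mem_FP ?_ (fanoutFn_mem_FP idF_mem_FP (const_mem_FP _)))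
  refine iterate_mem_FP_of_growth (fanoutFn_mem_FP fstF_mem_FP (comp_mem_FP succF_mem_FP sndF_mem_FP)) 4
    (fun w => by simp [fstF]) (fun w => ?_) X
  have h := length_fstF_sndF_le w
  have hs : (succF (sndF w)).length ≤ (sndF w).length + 2 := by
    rw [succF_apply]
    have h1 := length_encodeNat_bitsToNat_le (Com.addRes (sndF w) [true])
    rw [Com.bitsToNat_addRes] at h1
    have h2 := Com.length_addRes_le (sndF w) [true]
    simp at h1 h2 ⊢; omega
  rw [length_fanoutFn]
  have e : (boolUnpair w).1 = fstF w := rfl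
  rw [e]
  simp only [Function.comp_apply]
  omega

/-! ### Iterates of a counted loop: first field and state size -/

/-- The first field is kept along a counted loop. [folklore] -/
theorem fstF_iterate_loopStep (body : List Bool → List Bool) : ∀ (n : ℕ) (z : List Bool),
    fstF ((loopStep body)^[n] z) = fstF z
  | 0, z => rfl
  | n + 1, z => by rw [Function.iterate_succ_apply', fstF_loopStep, fstF_iterate_loopStep body n z]

/-- **Size of the state along a counted loop**: with a body of growth `c (|x| + 1)` per round,
after `n` rounds the state has grown by at most `n c (|x| + 1)` — on every input. [folklore] -/
theorem length_state_iterate_le {body : List Bool → List Bool} {c : ℕ}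
    (hbody : ∀ z, (body z).length ≤ (sndPow 1 z).length + c * ((fstF z).length + 1)) : ∀ (n : ℕ) (z : List Bool),
    (sndPow 1 ((loopStep body)^[n] z)).length ≤ (sndPow 1 z).length + n * (c * ((fstF z).length + 1))
  | 0, z => by simp
  | n + 1, z => by
    rw [Function.iterate_succ_apply']
    have ih := length_state_iterate_le hbody n z
    have hx := fstF_iterate_loopStep body n z
    have h1 : (sndPow 1 (loopStep body ((loopStep body)^[n] z))).length ≤
        (sndPow 1 ((loopStep body)^[n] z)).length + c * ((fstF z).length + 1) := by
      rw [loopStep, iteFn_of_oneBit (oneBit_isNilFn.comp _)]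
      split_ifs
      · simp
      · simp only [fanoutFn_apply, sndPow_succ_boolPair, sndPow_zero_boolPair]
        have := hbody ((loopStep body)^[n] z); rw [hx] at this; exact this
    rw [Nat.succ_mul]; omega

/-! ### Powers of two -/

/-- Body of the doubling loop: prepend a `0` to the state. [folklore] -/
def pow2Body : List Bool → List Bool := List.cons false ∘ sndPow 1

/-- `pow2F ⟨v, j⟩ = encodeNat 2^⟦j⟧` for `⟦j⟧ ≤ |v|`: `⟦j⟧` doublings of `1` (counted loop with
counter `j`, `|v|` rounds available). [folklore] -/
def pow2F : List Bool → List Bool :=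
  sndPow 1 ∘ (fun z => (loopStep pow2Body)^[(X : Polynomial ℕ).eval (fstF z).length] z) ∘
    fanoutFn fstF (fanoutFn sndF (fun _ => [true]))

/-- The canonical numeral of a power of two (also proved, in an unrelated development, as
`TavRecode.encodeNat_two_pow`; a private copy avoids the heavy import). [folklore] -/
private theorem encodeNat_two_pow (k : ℕ) : encodeNat (2 ^ k) = List.replicate k false ++ [true] := by
  have hc : IsCanonicalNum (List.replicate k false ++ [true]) := Or.inr (by simp)
  rw [← encodeNat_bitsToNat hc, bitsToNat_append]
  simp

/-- The model of the doubling loop. [folklore] -/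
theorem loopModel_pow2Body (x : List Bool) : ∀ (k : ℕ) (s : List Bool), loopModel pow2Body x k s = List.replicate k false ++ s
  | 0, s => by simp [loopModel]
  | k + 1, s => by
    rw [loopModel, loopModel_pow2Body x k]
    simp [pow2Body, List.replicate_succ']

/-- **`pow2F ⟨v, encodeNat j⟩ = encodeNat 2^j`** for `j ≤ |v|`. [folklore] -/
theorem pow2F_apply {v : List Bool} {j : ℕ} (hj : j ≤ v.length) : pow2F (boolPair v (encodeNat j)) = encodeNat (2 ^ j) := by
  simp only [pow2F, Function.comp_apply, fanoutFn_apply, fstF_boolPair, sndF_boolPair, eval_X]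
  rw [iterate_loopStep pow2Body v j v.length [true] hj, loopModel_pow2Body, encodeNat_two_pow]
  simp

/-- The output of `pow2F` is at most one symbol longer than its first field (also on malformed
inputs): `|v|` rounds, one symbol each. [folklore] -/
theorem length_pow2F_le (w : List Bool) : (pow2F w).length ≤ (fstF w).length + 1 := by
  simp only [pow2F, Function.comp_apply, eval_X]
  set z0 := fanoutFn fstF (fanoutFn sndF fun _ => [true]) w
  have hz0f : fstF z0 = fstF w := by simp [z0]
  have hz0s : sndPow 1 z0 = [true] := by simp [z0]
  have := length_fstF_sndF_le w
  -- `pow2Body` adds exactly one symbol per round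
  have key : ∀ (n : ℕ) (z : List Bool), (sndPow 1 ((loopStep pow2Body)^[n] z)).length ≤ (sndPow 1 z).length + n := by
    intro n
    induction n with
    | zero => intro z; simp
    | succ n ih =>
      intro z
      rw [Function.iterate_succ_apply']
      have hz := ih z
      have h1 : (sndPow 1 (loopStep pow2Body ((loopStep pow2Body)^[n] z))).length ≤ (sndPow 1 ((loopStep pow2Body)^[n] z)).length + 1 := by
        rw [loopStep, iteFn_of_oneBit (oneBit_isNilFn.comp _)]
        split_ifs
        · simp
        · simp [pow2Body]
      omega
  have h2 := key (fstF z0).length z0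
  rw [hz0s, hz0f] at h2
  rw [hz0f]
  simp only [List.length_singleton] at h2
  omega

/-- `pow2F ∈ FP`. [folklore] -/
theorem pow2F_mem_FP : pow2F ∈ FP := by
  refine comp_mem_FP (sndPow_mem_FP 1) (comp_mem_FP ?_ (fanoutFn_mem_FP fstF_mem_FP (fanoutFn_mem_FP sndF_mem_FP (const_mem_FP _))))
  exact loopFn_mem_FP (comp_mem_FP (cons_mem_FP false) (sndPow_mem_FP 1)) (c := 1) (fun z => by simp) X

/-! ### The capped power accumulator -/

/-- Context of the accumulator loop: `x = ⟨v, c⟩`; its parts. [folklore] -/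
def vOf : List Bool → List Bool := fstF ∘ nthF 0
/-- The base `c` of the accumulator loop. [folklore] -/
def cOf : List Bool → List Bool := sndF ∘ nthF 0

/-- Body of the accumulator loop: `acc := acc` if `⟦v⟧ < ⟦acc⟧` (frozen), else `acc · c`.
[folklore] -/
def powBody : List Bool → List Bool :=
  iteFn (ltFn ∘ fanoutFn vOf (sndPow 1)) (sndPow 1) (prodFn ∘ fanoutFn (sndPow 1) cOf)

/-- `powBody ∈ FP`. [folklore] -/
theorem powBody_mem_FP : powBody ∈ FP :=
  iteFn_mem_FP (comp_mem_FP ltFn_mem_FP (fanoutFn_mem_FP (comp_mem_FP fstF_mem_FP (nthF_mem_FP 0)) (sndPow_mem_FP 1)))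
    (sndPow_mem_FP 1) (comp_mem_FP prodFn_mem_FP (fanoutFn_mem_FP (sndPow_mem_FP 1) (comp_mem_FP sndF_mem_FP (nthF_mem_FP 0))))

/-- `powBody` on a record. [folklore] -/
theorem powBody_apply (v c cnt acc : List Bool) :
    powBody (boolPair (boolPair v c) (boolPair cnt acc)) =
      if bitsToNat v < bitsToNat acc then acc else encodeNat (bitsToNat acc * bitsToNat c) := by
  have hc : (ltFn ∘ fanoutFn vOf (sndPow 1)) (boolPair (boolPair v c) (boolPair cnt acc)) = [decide (bitsToNat v < bitsToNat acc)] := by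
    simp [vOf]
  by_cases h : bitsToNat v < bitsToNat acc
  · rw [if_pos h, powBody, iteFn_apply_true (by rw [hc]; simp [h])]
    simp
  · rw [if_neg h, powBody, iteFn_apply_false (by rw [hc]; simp [h])]
    simp [cOf, prodFn_boolPair]

/-- The model of the accumulator: multiply by `c`, `k` times, freezing above `v`. [folklore] -/
def accModel (v c : ℕ) : ℕ → ℕ → ℕ
  | 0, a => a
  | k + 1, a => accModel v c k (if v < a then a else a * c)

/-- A frozen accumulator stays. [folklore] -/
theorem accModel_of_lt {v c : ℕ} : ∀ (k a : ℕ), v < a → accModel v c k a = a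
  | 0, a, _ => rfl
  | k + 1, a, h => by rw [accModel, if_pos h, accModel_of_lt k a h]

/-- **The accumulator decides `a · c^k ≤ v` and `a · c^k = v`** (for `c ≥ 1`). [folklore] -/
theorem accModel_spec {v c : ℕ} (hc : 1 ≤ c) : ∀ (k a : ℕ), 1 ≤ a →
    (a * c ^ k ≤ v ↔ accModel v c k a ≤ v) ∧ (a * c ^ k = v ↔ accModel v c k a = v)
  | 0, a, _ => by simp [accModel]
  | k + 1, a, ha => by
    rw [accModel]
    by_cases h : v < a
    · rw [if_pos h, accModel_of_lt k a h]
      have : v < a * c ^ (k + 1) := h.trans_le (Nat.le_mul_of_pos_right _ (Nat.pow_pos hc))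
      constructor <;> constructor <;> intro <;> omega
    · rw [if_neg h]
      have := accModel_spec (v := v) hc k (a * c) (Nat.le_mul_of_pos_right _ hc |>.trans' ha)
      rw [pow_succ', ← mul_assoc]
      exact this

/-- Bound on the accumulator: it never exceeds `max a (v · c)`. [folklore] -/
theorem accModel_le {v c : ℕ} : ∀ (k a : ℕ), accModel v c k a ≤ max a (v * c)
  | 0, a => le_max_left _ _
  | k + 1, a => by
    rw [accModel]
    split_ifs with h
    · rw [accModel_of_lt k a h]; exact le_max_left _ _
    · push Not at h
      refine (accModel_le k (a * c)).trans (max_le ?_ (le_max_right _ _))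
      exact (Nat.mul_le_mul_right c h).trans (le_max_right _ _)

/-- The loop model of `powBody` is `accModel` on values (from a canonical accumulator).
[folklore] -/
theorem loopModel_powBody (v c : List Bool) : ∀ (k a : ℕ),
    loopModel powBody (boolPair v c) k (encodeNat a) = encodeNat (accModel (bitsToNat v) (bitsToNat c) k a)
  | 0, a => by simp [loopModel, accModel]
  | k + 1, a => by
    rw [loopModel, powBody_apply, accModel]
    simp only [bitsToNat_encodeNat]
    split_ifs
    · exact loopModel_powBody v c k a
    · rw [loopModel_powBody v c k]

/-- `powAccF ⟨v, ⟨c, k⟩⟩`: the accumulator after `⟦k⟧` rounds from `1` (needs `⟦k⟧ ≤ 2|v| + 2`,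
the rounds available being `|⟨v, c⟩|`). [folklore] -/
def powAccF : List Bool → List Bool :=
  sndPow 1 ∘ (fun z => (loopStep powBody)^[(X : Polynomial ℕ).eval (fstF z).length] z) ∘
    fanoutFn (fanoutFn (nthF 0) (nthF 1)) (fanoutFn (sndPow 1) (fun _ => [true]))

/-- **Value of `powAccF`** on `⟨v, ⟨c, encodeNat k⟩⟩` with `k ≤ |v|`. [folklore] -/
theorem powAccF_apply (v c : List Bool) {k : ℕ} (hk : k ≤ v.length) :
    powAccF (boolPair v (boolPair c (encodeNat k))) = encodeNat (accModel (bitsToNat v) (bitsToNat c) k 1) := by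
  simp only [powAccF, Function.comp_apply, fanoutFn_apply, nthF_zero_boolPair, nthF_succ_boolPair, fstF_boolPair,
    sndPow_succ_boolPair, sndPow_zero_boolPair, eval_X]
  rw [iterate_loopStep powBody _ k _ [true] (by rw [length_boolPair]; omega)]
  rw [show ([true] : List Bool) = encodeNat 1 from rfl, loopModel_powBody]
  simp

/-- Growth of the accumulator body: `|powBody z| ≤ |sndPow 1 z| + |fstF z|`. [folklore] -/
theorem length_powBody_le (z : List Bool) : (powBody z).length ≤ (sndPow 1 z).length + 1 * ((fstF z).length + 1) := by
  obtain ⟨b, hb⟩ := (oneBit_ltFn.comp (fanoutFn vOf (sndPow 1))) z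
  cases b
  · rw [powBody, iteFn_apply_false hb]
    simp only [Function.comp_apply, fanoutFn_apply, prodFn_boolPair, cOf]
    have h1 := length_encodeNat_mul_le (sndPow 1 z) (sndF (nthF 0 z))
    have h2 := length_fstF_sndF_le (nthF 0 z)
    simp only [nthF_zero] at h1 h2 ⊢
    omega
  · rw [powBody, iteFn_apply_true hb]
    omega

/-- `powAccF ∈ FP`. [folklore] -/
theorem powAccF_mem_FP : powAccF ∈ FP := by
  refine comp_mem_FP (sndPow_mem_FP 1) (comp_mem_FP ?_ (fanoutFn_mem_FP (fanoutFn_mem_FP (nthF_mem_FP 0) (nthF_mem_FP 1))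
    (fanoutFn_mem_FP (sndPow_mem_FP 1) (const_mem_FP _))))
  exact loopFn_mem_FP powBody_mem_FP length_powBody_le X

/-- The output of `powAccF` is polynomially bounded (also on malformed inputs). [folklore] -/
theorem length_powAccF_le (w : List Bool) : (powAccF w).length ≤ 1 + (2 * w.length + 2) * (2 * w.length + 3) := by
  simp only [powAccF, Function.comp_apply, eval_X]
  set z0 := fanoutFn (fanoutFn (nthF 0) (nthF 1)) (fanoutFn (sndPow 1) fun _ => [true]) w
  have h := length_state_iterate_le (body := powBody) (c := 1) length_powBody_le (fstF z0).length z0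
  have hz0f : fstF z0 = boolPair (nthF 0 w) (nthF 1 w) := by simp [z0]
  have hz0s : sndPow 1 z0 = [true] := by simp [z0]
  rw [hz0s] at h
  have hl : (fstF z0).length ≤ 2 * w.length + 2 := by
    rw [hz0f, length_boolPair]
    have h1 := length_fstF_sndF_le w
    have h2 : 2 * (nthF 1 w).length + (sndPow 1 w).length ≤ (sndF w).length := length_nthF_succ_add_sndPow_succ_le 0 w
    have e : nthF 0 w = fstF w := rfl
    rw [e]
    omega
  refine h.trans ?_
  have : (fstF z0).length * (1 * ((fstF z0).length + 1)) ≤ (2 * w.length + 2) * (2 * w.length + 3) :=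
    Nat.mul_le_mul hl (by omega)
  simp only [List.length_singleton]
  omega

/-! ### Comparisons with a power -/

/-- `powLeF ⟨v, ⟨c, k⟩⟩ = [decide (⟦c⟧ ^ ⟦k⟧ ≤ ⟦v⟧)]` (for `⟦c⟧ ≥ 1`, `⟦k⟧ ≤ |v|`): not
`⟦v⟧ < accumulator`. [folklore] -/
def powLeF : List Bool → List Bool := notFn (ltFn ∘ fanoutFn (nthF 0) powAccF)

/-- `powLeF` is one-bit. [folklore] -/
theorem oneBit_powLeF : OneBit powLeF := oneBit_notFn (oneBit_ltFn.comp _)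

/-- `powLeF ∈ FP`. [folklore] -/
theorem powLeF_mem_FP : powLeF ∈ FP :=
  notFn_mem_FP (comp_mem_FP ltFn_mem_FP (fanoutFn_mem_FP (nthF_mem_FP 0) powAccF_mem_FP))

/-- **Value of `powLeF`.** [folklore] -/
theorem powLeF_apply (v c : List Bool) {k : ℕ} (hk : k ≤ v.length) (hc : 1 ≤ bitsToNat c) :
    powLeF (boolPair v (boolPair c (encodeNat k))) = [decide (bitsToNat c ^ k ≤ bitsToNat v)] := by
  have hacc := powAccF_apply v c hk
  obtain ⟨h1, -⟩ := accModel_spec (v := bitsToNat v) hc k 1 le_rfl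
  rw [one_mul] at h1
  have hlt : (ltFn ∘ fanoutFn (nthF 0) powAccF) (boolPair v (boolPair c (encodeNat k))) =
      [decide (bitsToNat v < accModel (bitsToNat v) (bitsToNat c) k 1)] := by
    simp [hacc]
  rw [powLeF, notFn_apply hlt]
  by_cases h : bitsToNat c ^ k ≤ bitsToNat v
  · have := h1.1 h; simp [h, not_lt.2 this]
  · have : ¬ accModel (bitsToNat v) (bitsToNat c) k 1 ≤ bitsToNat v := fun h' => h (h1.2 h')
    simp [h, not_le.1 this]

/-- `powEqF ⟨v, ⟨c, k⟩⟩ = [decide (⟦c⟧ ^ ⟦k⟧ = ⟦v⟧)]` (same provisos): `≤` and not `accumulator < ⟦v⟧`.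
[folklore] -/
def powEqF : List Bool → List Bool := andFn powLeF (notFn (ltFn ∘ fanoutFn powAccF (nthF 0)))

/-- `powEqF` is one-bit. [folklore] -/
theorem oneBit_powEqF : OneBit powEqF := oneBit_andFn oneBit_powLeF (oneBit_notFn (oneBit_ltFn.comp _))

/-- `powEqF ∈ FP`. [folklore] -/
theorem powEqF_mem_FP : powEqF ∈ FP :=
  andFn_mem_FP powLeF_mem_FP (notFn_mem_FP (comp_mem_FP ltFn_mem_FP (fanoutFn_mem_FP powAccF_mem_FP (nthF_mem_FP 0))))

/-- **Value of `powEqF`.** [folklore] -/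
theorem powEqF_apply (v c : List Bool) {k : ℕ} (hk : k ≤ v.length) (hc : 1 ≤ bitsToNat c) :
    powEqF (boolPair v (boolPair c (encodeNat k))) = [decide (bitsToNat c ^ k = bitsToNat v)] := by
  have hacc := powAccF_apply v c hk
  obtain ⟨h1, h2⟩ := accModel_spec (v := bitsToNat v) hc k 1 le_rfl
  rw [one_mul] at h1 h2
  have hle := powLeF_apply v c hk hc
  have hlt : (notFn (ltFn ∘ fanoutFn powAccF (nthF 0))) (boolPair v (boolPair c (encodeNat k))) =
      [!decide (accModel (bitsToNat v) (bitsToNat c) k 1 < bitsToNat v)] :=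
    notFn_apply (by simp [hacc])
  rw [powEqF, andFn_apply hle hlt]
  congr 1
  by_cases h : bitsToNat c ^ k = bitsToNat v
  · have e := h2.1 h
    simp [h, e]
  · have hne : accModel (bitsToNat v) (bitsToNat c) k 1 ≠ bitsToNat v := fun e => h (h2.2 e)
    by_cases hle' : bitsToNat c ^ k ≤ bitsToNat v
    · have : accModel (bitsToNat v) (bitsToNat c) k 1 < bitsToNat v := lt_of_le_of_ne (h1.1 hle') hne
      simp [h, this]
    · simp [h, hle']

/-! ### The integer root by the digit scan -/

/-- The context of the root loop: `x = ⟨v, k⟩`. [folklore] -/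
def rvOf : List Bool → List Bool := fstF ∘ nthF 0
/-- The exponent of the root loop. [folklore] -/
def rkOf : List Bool → List Bool := sndF ∘ nthF 0

/-- The candidate `b + 2^j` (`j` = counter − 1). [folklore] -/
def candF : List Bool → List Bool := addFn ∘ fanoutFn (sndPow 1) (pow2F ∘ fanoutFn rvOf predCntF)

/-- Body of the root loop: take the candidate if its `k`-th power still fits under `v`.
[folklore] -/
def rootBody : List Bool → List Bool :=
  iteFn (powLeF ∘ fanoutFn rvOf (fanoutFn candF rkOf)) candF (sndPow 1)

/-- `candF ∈ FP`. [folklore] -/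
theorem candF_mem_FP : candF ∈ FP :=
  comp_mem_FP addFn_mem_FP (fanoutFn_mem_FP (sndPow_mem_FP 1) (comp_mem_FP pow2F_mem_FP
    (fanoutFn_mem_FP (comp_mem_FP fstF_mem_FP (nthF_mem_FP 0)) predCntF_mem_FP)))

/-- `rootBody ∈ FP`. [folklore] -/
theorem rootBody_mem_FP : rootBody ∈ FP :=
  iteFn_mem_FP (comp_mem_FP powLeF_mem_FP (fanoutFn_mem_FP (comp_mem_FP fstF_mem_FP (nthF_mem_FP 0))
    (fanoutFn_mem_FP candF_mem_FP (comp_mem_FP sndF_mem_FP (nthF_mem_FP 0))))) candF_mem_FP (sndPow_mem_FP 1)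

/-- `candF` on a record (counter `j + 1 ≤ |v|`). [folklore] -/
theorem candF_apply (v ks : List Bool) {j b : ℕ} (hj : j + 1 ≤ v.length) :
    candF (boolPair (boolPair v ks) (boolPair (encodeNat (j + 1)) (encodeNat b))) = encodeNat (b + 2 ^ j) := by
  have hp := pow2F_apply (v := v) (j := j) (by omega)
  simp [candF, rvOf, predCntF_apply, hp]

/-- `rootBody` on a record (counter `j + 1 ≤ |v|`, exponent `1 ≤ ⟦ks⟧ ≤ |v|`). [folklore] -/
theorem rootBody_apply (v ks : List Bool) {j b : ℕ} (hj : j + 1 ≤ v.length) (hk : bitsToNat ks ≤ v.length)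
    (hks : ks = encodeNat (bitsToNat ks)) :
    rootBody (boolPair (boolPair v ks) (boolPair (encodeNat (j + 1)) (encodeNat b))) =
      encodeNat (if (b + 2 ^ j) ^ bitsToNat ks ≤ bitsToNat v then b + 2 ^ j else b) := by
  have hcand := candF_apply v ks (b := b) hj
  have hcond : (powLeF ∘ fanoutFn rvOf (fanoutFn candF rkOf)) (boolPair (boolPair v ks) (boolPair (encodeNat (j + 1)) (encodeNat b))) =
      [decide ((b + 2 ^ j) ^ bitsToNat ks ≤ bitsToNat v)] := by
    simp only [Function.comp_apply, fanoutFn_apply, rvOf, rkOf, nthF_zero, fstF_boolPair, sndF_boolPair, hcand]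
    conv_lhs => rw [hks]
    rw [powLeF_apply v _ hk (by simp; have := Nat.one_le_two_pow (n := j); omega)]
    simp
  by_cases h : (b + 2 ^ j) ^ bitsToNat ks ≤ bitsToNat v
  · rw [if_pos h, rootBody, iteFn_apply_true (by rw [hcond]; simp [h]), hcand]
  · rw [if_neg h, rootBody, iteFn_apply_false (by rw [hcond]; simp [h])]
    simp

/-- The model of the scan as a counted loop: counter `c` means bit `c - 1`. [folklore] -/
def scanModel (v k : ℕ) : ℕ → ℕ → ℕ
  | 0, b => b
  | c + 1, b => scanModel v k c (if (b + 2 ^ c) ^ k ≤ v then b + 2 ^ c else b)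

/-- **The counted-loop scan is `rootScan`.** [folklore] -/
theorem scanModel_succ_eq_rootScan (v k : ℕ) : ∀ (J b : ℕ), scanModel v k (J + 1) b = Shor1997.rootScan v k J b
  | 0, b => by simp [scanModel, Shor1997.rootScan]
  | J + 1, b => by
    rw [scanModel, scanModel_succ_eq_rootScan v k J, Shor1997.rootScan]

/-- The loop model of `rootBody` is `scanModel` (counter `≤ |v|`, canonical exponent). [folklore] -/
theorem loopModel_rootBody (v ks : List Bool) (hk : bitsToNat ks ≤ v.length) (hks : ks = encodeNat (bitsToNat ks)) :
    ∀ (c b : ℕ), c ≤ v.length → loopModel rootBody (boolPair v ks) c (encodeNat b) = encodeNat (scanModel (bitsToNat v) (bitsToNat ks) c b)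
  | 0, b, _ => by simp [loopModel, scanModel]
  | c + 1, b, hc => by
    rw [loopModel, rootBody_apply v ks hc hk hks, loopModel_rootBody v ks hk hks c _ (by omega), scanModel]

/-- `rootF ⟨v, k⟩ = encodeNat (Nat.nthRoot ⟦k⟧ ⟦v⟧)`: the scan over `|v|` bits from `b = 0`.
[cite: Cohen1993, §1.7 (integer roots)] -/
def rootF : List Bool → List Bool :=
  sndPow 1 ∘ (fun z => (loopStep rootBody)^[(X : Polynomial ℕ).eval (fstF z).length] z) ∘
    fanoutFn idF (fanoutFn (lenBinF ∘ fstF) (fun _ => []))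

/-- **Value of `rootF`** (canonical exponent `1 ≤ k ≤ |v|`). [folklore] -/
theorem rootF_apply (v : List Bool) {k : ℕ} (hk1 : 1 ≤ k) (hkv : k ≤ v.length) :
    rootF (boolPair v (encodeNat k)) = encodeNat (Nat.nthRoot k (bitsToNat v)) := by
  have hks : encodeNat k = encodeNat (bitsToNat (encodeNat k)) := by simp
  simp only [rootF, Function.comp_apply, fanoutFn_apply, idF, fstF_boolPair, lenBinF_apply, eval_X]
  rw [iterate_loopStep rootBody _ v.length _ [] (by rw [length_boolPair]; omega)]
  rw [show ([] : List Bool) = encodeNat 0 from rfl, loopModel_rootBody v (encodeNat k) (by simpa using hkv) hks v.length 0 le_rfl]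
  simp only [sndPow_succ_boolPair, sndPow_zero_boolPair, bitsToNat_encodeNat]
  congr 1
  rcases Nat.eq_zero_or_pos v.length with h0 | hpos
  · have hv : v = [] := List.eq_nil_of_length_eq_zero h0
    subst hv
    simp [scanModel, Nat.nthRoot_zero_right (show k ≠ 0 by omega)]
  · obtain ⟨J, hJ⟩ : ∃ J, v.length = J + 1 := ⟨v.length - 1, by omega⟩
    rw [hJ, scanModel_succ_eq_rootScan]
    refine Shor1997.rootScan_eq_nthRoot hk1 ?_
    rw [← hJ]
    calc Nat.nthRoot k (bitsToNat v) ≤ bitsToNat v := by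
          rw [← Nat.lt_succ_iff, Nat.nthRoot_lt_iff (show k ≠ 0 by omega)]
          exact (Nat.lt_succ_self _).trans_le (Nat.le_self_pow (by omega) _)
      _ < 2 ^ v.length := bitsToNat_lt v

/-- Growth of the root body: `|rootBody z| ≤ |sndPow 1 z| + 3 (|fstF z| + 1)`. [folklore] -/
theorem length_rootBody_le (z : List Bool) : (rootBody z).length ≤ (sndPow 1 z).length + 3 * ((fstF z).length + 1) := by
  have hcand : (candF z).length ≤ (sndPow 1 z).length + (fstF z).length + 3 := by
    simp only [candF, Function.comp_apply, fanoutFn_apply, addFn_boolPair]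
    set p2 := pow2F (boolPair (rvOf z) (predCntF z))
    have hp2 : p2.length ≤ (fstF z).length + 1 := by
      refine (length_pow2F_le _).trans ?_
      simp only [fstF_boolPair, rvOf, Function.comp_apply, nthF_zero]
      have := length_fstF_sndF_le (fstF z); omega
    have h1 := length_encodeNat_bitsToNat_le (Com.addRes (sndPow 1 z) p2)
    rw [Com.bitsToNat_addRes] at h1
    have h2 := Com.length_addRes_le (sndPow 1 z) p2
    omega
  obtain ⟨b, hb⟩ := (oneBit_powLeF.comp (fanoutFn rvOf (fanoutFn candF rkOf))) z
  cases b
  · rw [rootBody, iteFn_apply_false hb]; omega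
  · rw [rootBody, iteFn_apply_true hb]; omega

/-- `rootF ∈ FP`. [folklore] -/
theorem rootF_mem_FP : rootF ∈ FP := by
  refine comp_mem_FP (sndPow_mem_FP 1) (comp_mem_FP ?_ (fanoutFn_mem_FP idF_mem_FP
    (fanoutFn_mem_FP (comp_mem_FP lenBinF_mem_FP fstF_mem_FP) (const_mem_FP _))))
  exact loopFn_mem_FP rootBody_mem_FP length_rootBody_le X

/-- The output of `rootF` is quadratically bounded (also on malformed inputs). [folklore] -/
theorem length_rootF_le (w : List Bool) : (rootF w).length ≤ 3 * (w.length + 1) ^ 2 := by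
  have aux : ∀ z0 : List Bool, (sndPow 1 ((loopStep rootBody)^[(fstF z0).length] z0)).length ≤
      (sndPow 1 z0).length + (fstF z0).length * (3 * ((fstF z0).length + 1)) := fun z0 =>
    length_state_iterate_le (body := rootBody) (c := 3) length_rootBody_le (fstF z0).length z0
  simp only [rootF, Function.comp_apply, eval_X]
  refine (aux _).trans ?_
  simp only [fanoutFn_apply, fstF_boolPair, sndPow_succ_boolPair, sndPow_zero_boolPair, idF, List.length_nil, zero_add]
  nlinarith

/-- Lengths through a one-bit branch. [folklore] -/
theorem length_iteFn_le {c : List Bool → List Bool} (hc : OneBit c) (f g : List Bool → List Bool) (z : List Bool) :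
    (iteFn c f g z).length ≤ max (f z).length (g z).length := by
  obtain ⟨b, hb⟩ := hc z
  rw [iteFn_apply hb]
  cases b <;> simp

/-! ### The perfect-power search -/

/-- The exponent tried at counter `cnt`: `⟦cnt⟧ + 1`. [folklore] -/
def kkF : List Bool → List Bool := succF ∘ nthF 1
/-- The root for that exponent. [folklore] -/
def rF : List Bool → List Bool := rootF ∘ fanoutFn (nthF 0) kkF
/-- Is it exact. [folklore] -/
def eqF : List Bool → List Bool := powEqF ∘ fanoutFn (nthF 0) (fanoutFn rF kkF)

/-- `lenLeFn p` is one-bit (`LengthCompare.lenLeFn_eq_or`). [folklore] -/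
theorem oneBit_lenLeFn (p : Polynomial ℕ) : OneBit (lenLeFn p) := fun w => by
  rcases lenLeFn_eq_or p w with h | h
  · exact ⟨true, h⟩
  · exact ⟨false, h⟩

/-- The root, capped at the length of `m` (always true of a genuine root `≤ m`; the cap keeps the
loop's growth linear on malformed inputs). [folklore] -/
def capF : List Bool → List Bool := iteFn (lenLeFn X ∘ fanoutFn (nthF 0) rF) rF (fun _ => [])

/-- The cap is harmless on a short root and in any case short. [folklore] -/
theorem capF_eq_of_le {z : List Bool} (h : (rF z).length ≤ (nthF 0 z).length) : capF z = rF z := by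
  rw [capF, iteFn_apply_true]
  simp only [Function.comp_apply, fanoutFn_apply, lenLeFn_boolPair, eval_X]
  simp only [nthF_zero] at h ⊢
  simp [h]

/-- The capped root is never longer than the first field. [folklore] -/
theorem length_capF_le (z : List Bool) : (capF z).length ≤ (nthF 0 z).length := by
  by_cases h : (rF z).length ≤ (nthF 0 z).length
  · rw [capF_eq_of_le h]; exact h
  · rw [capF, iteFn_apply_false]
    · simp
    · simp only [Function.comp_apply, fanoutFn_apply, lenLeFn_boolPair, eval_X]
      simp only [nthF_zero] at h ⊢
      simp [h]

/-- Body of the search: if nothing found yet (flag field empty), try the current exponent.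
[cite: Cohen1993, §1.7 (power detection: k-th roots for k ≤ lg n)] -/
def ppBody : List Bool → List Bool :=
  iteFn (isNilFn ∘ fstF ∘ sndPow 1)
    (iteFn eqF (fanoutFn (fun _ => [true]) capF) (fanoutFn (fun _ => []) (fun _ => [])))
    (sndPow 1)

/-- `ppBody ∈ FP`. [folklore] -/
theorem ppBody_mem_FP : ppBody ∈ FP := by
  have hkk : kkF ∈ FP := comp_mem_FP succF_mem_FP (nthF_mem_FP 1)
  have hr : rF ∈ FP := comp_mem_FP rootF_mem_FP (fanoutFn_mem_FP (nthF_mem_FP 0) hkk)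
  have he : eqF ∈ FP := comp_mem_FP powEqF_mem_FP (fanoutFn_mem_FP (nthF_mem_FP 0) (fanoutFn_mem_FP hr hkk))
  have hcap : capF ∈ FP := iteFn_mem_FP (comp_mem_FP (lenLeFn_mem_FP X) (fanoutFn_mem_FP (nthF_mem_FP 0) hr)) hr (const_mem_FP _)
  exact iteFn_mem_FP (comp_mem_FP isNilFn_mem_FP (comp_mem_FP fstF_mem_FP (sndPow_mem_FP 1)))
    (iteFn_mem_FP he (fanoutFn_mem_FP (const_mem_FP _) hcap) (fanoutFn_mem_FP (const_mem_FP _) (const_mem_FP _))) (sndPow_mem_FP 1)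

/-- The test predicate of the search: `k ≥ 2` and `m` is a perfect `k`-th power. [folklore] -/
def IsPP (v k : ℕ) : Prop := 2 ≤ k ∧ Nat.nthRoot k v ^ k = v

/-- `IsPP` is decidable. [folklore] -/
instance (v k : ℕ) : Decidable (IsPP v k) := by unfold IsPP; infer_instance

/-- The state of the search coded: `none ↦ ⟨[], []⟩`, `some r ↦ ⟨[true], encodeNat r⟩`. [folklore] -/
def ppState : Option ℕ → List Bool
  | none => boolPair [] []
  | some r => boolPair [true] (encodeNat r)

/-- `ppBody` on a record: flag set keeps; otherwise try `k = ⟦cnt⟧ + 1` (`2 ≤ k ≤ |m|`, `⟦m⟧ ≥ 1`).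
[folklore] -/
theorem ppBody_apply (m : List Bool) {j : ℕ} (hj : j + 1 ≤ m.length) (hm : 1 ≤ bitsToNat m) (o : Option ℕ) :
    ppBody (boolPair m (boolPair (encodeNat j) (ppState o))) =
      ppState (o.or (if Nat.nthRoot (j + 1) (bitsToNat m) ^ (j + 1) = bitsToNat m then some (Nat.nthRoot (j + 1) (bitsToNat m)) else none)) := by
  cases o with
  | some r =>
    rw [ppBody, iteFn_apply_false (by simp [ppState, isNilFn])]
    simp [ppState]
  | none =>
    simp only [ppState]
    have hkk : kkF (boolPair m (boolPair (encodeNat j) (boolPair [] []))) = encodeNat (j + 1) := by simp [kkF]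
    have hr : rF (boolPair m (boolPair (encodeNat j) (boolPair [] []))) = encodeNat (Nat.nthRoot (j + 1) (bitsToNat m)) := by
      simp only [rF, Function.comp_apply, fanoutFn_apply, nthF_zero, fstF_boolPair, hkk]
      exact rootF_apply m (by omega) hj
    have hroot1 : 1 ≤ Nat.nthRoot (j + 1) (bitsToNat m) := by
      rw [Nat.le_nthRoot_iff (by omega), one_pow]; exact hm
    have he : eqF (boolPair m (boolPair (encodeNat j) (boolPair [] []))) =
        [decide (Nat.nthRoot (j + 1) (bitsToNat m) ^ (j + 1) = bitsToNat m)] := by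
      simp only [eqF, Function.comp_apply, fanoutFn_apply, nthF_zero, fstF_boolPair, hkk, hr]
      rw [powEqF_apply m _ hj (by simpa using hroot1)]
      simp
    have hcap : capF (boolPair m (boolPair (encodeNat j) (boolPair [] []))) = encodeNat (Nat.nthRoot (j + 1) (bitsToNat m)) := by
      rw [capF_eq_of_le, hr]
      rw [hr, nthF_zero_boolPair]
      refine (length_encodeNat_mono ?_).trans (length_encodeNat_bitsToNat_le m)
      rw [← Nat.lt_succ_iff, Nat.nthRoot_lt_iff (show j + 1 ≠ 0 by omega)]
      exact (Nat.lt_succ_self _).trans_le (Nat.le_self_pow (by omega) _)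
    rw [ppBody, iteFn_apply_true (by simp [isNilFn])]
    by_cases h : Nat.nthRoot (j + 1) (bitsToNat m) ^ (j + 1) = bitsToNat m
    · rw [iteFn_apply_true (by rw [he]; simp [h])]
      simp [h, hcap]
    · rw [iteFn_apply_false (by rw [he]; simp [h])]
      simp [h]

/-- The model of the search: at counter `c + 1` the exponent `c + 2` is tried. [folklore] -/
def ppModel (v : ℕ) : ℕ → Option ℕ → Option ℕ
  | 0, o => o
  | c + 1, o => ppModel v c (o.or (if Nat.nthRoot (c + 2) v ^ (c + 2) = v then some (Nat.nthRoot (c + 2) v) else none))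

/-- The loop model of `ppBody` is `ppModel` (counter `c` with `c + 1 ≤ |m|`). [folklore] -/
theorem loopModel_ppBody (m : List Bool) (hm : 1 ≤ bitsToNat m) :
    ∀ (c : ℕ) (o : Option ℕ), c + 1 ≤ m.length → loopModel ppBody m c (ppState o) = ppState (ppModel (bitsToNat m) c o)
  | 0, o, _ => by simp [loopModel, ppModel]
  | c + 1, o, hc => by
    rw [loopModel, ppBody_apply m hc hm o, loopModel_ppBody m hm c _ (by omega), ppModel]

/-- A found root stays. [folklore] -/
theorem ppModel_some (v : ℕ) : ∀ (c r : ℕ), ppModel v c (some r) = some r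
  | 0, r => rfl
  | c + 1, r => by rw [ppModel]; exact ppModel_some v c r

/-- **What the search finds**: from `none` at counter `c`, the root for the largest exponent
`k ≤ c + 1` with `IsPP v k`, if any. [folklore] -/
theorem ppModel_none (v : ℕ) : ∀ c : ℕ,
    ppModel v c none = if ∃ k, k ≤ c + 1 ∧ IsPP v k then some (Nat.nthRoot (Nat.findGreatest (IsPP v) (c + 1)) v) else none
  | 0 => by
    rw [ppModel, if_neg]
    rintro ⟨k, hk, hk2, -⟩; omega
  | c + 1 => by
    rw [ppModel]
    by_cases h : Nat.nthRoot (c + 2) v ^ (c + 2) = v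
    · have hpp : IsPP v (c + 2) := ⟨by omega, h⟩
      rw [if_pos h, Option.none_or, ppModel_some, if_pos ⟨c + 2, le_rfl, hpp⟩,
        Nat.findGreatest_eq (by exact hpp)]
    · rw [if_neg h, Option.none_or, ppModel_none v c,
        show c + 1 + 1 = c + 2 from rfl, Nat.findGreatest_of_not (fun hpp : IsPP v (c + 2) => h hpp.2)]
      have hiff : (∃ k, k ≤ c + 1 ∧ IsPP v k) ↔ (∃ k, k ≤ c + 2 ∧ IsPP v k) := by
        constructor
        · rintro ⟨k, hk, hp⟩; exact ⟨k, by omega, hp⟩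
        · rintro ⟨k, hk, hp⟩
          rcases Nat.lt_or_ge k (c + 2) with hlt | hge
          · exact ⟨k, by omega, hp⟩
          · obtain rfl : k = c + 2 := le_antisymm hk hge
            exact absurd hp.2 h
      by_cases hex : ∃ k, k ≤ c + 1 ∧ IsPP v k
      · rw [if_pos hex, if_pos (hiff.1 hex)]
      · rw [if_neg hex, if_neg (fun h' => hex (hiff.2 h'))]

/-- `ppF m = ⟨flag, base⟩`: run the search over the counters `|m| - 1, …, 1` (exponents
`|m|, …, 2`) from "nothing found", then report the flag as a bit. [cite: Cohen1993, §1.7 (power detection)] -/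
def ppF : List Bool → List Bool :=
  fanoutFn (notFn (isNilFn ∘ fstF ∘ sndPow 1)) (sndF ∘ sndPow 1) ∘
    (fun z => (loopStep ppBody)^[(X : Polynomial ℕ).eval (fstF z).length] z) ∘
    fanoutFn idF (fanoutFn (predF ∘ lenBinF) (fun _ => boolPair [] []))

/-- Growth of the search body: the state is kept, reset, or replaced by the capped root, so
`|ppBody z| ≤ |sndPow 1 z| + (|fstF z| + 4)`. [folklore] -/
theorem length_ppBody_le (z : List Bool) : (ppBody z).length ≤ (sndPow 1 z).length + 1 * ((fstF z).length + 4) := by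
  have hcap := length_capF_le z
  have hc1 : OneBit eqF := oneBit_powEqF.comp (fanoutFn (nthF 0) (fanoutFn rF kkF))
  have hinner : (iteFn eqF (fanoutFn (fun _ => [true]) capF) (fanoutFn (fun _ => []) (fun _ => [])) z).length ≤ (capF z).length + 4 := by
    refine (length_iteFn_le hc1 _ _ z).trans (max_le ?_ ?_)
    · rw [length_fanoutFn]; simp; omega
    · rw [length_fanoutFn]; simp
  have hc2 : OneBit (isNilFn ∘ fstF ∘ sndPow 1) := oneBit_isNilFn.comp _
  have houter := length_iteFn_le hc2 (iteFn eqF (fanoutFn (fun _ => [true]) capF) (fanoutFn (fun _ => []) (fun _ => [])))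
    (sndPow 1) z
  unfold ppBody
  refine houter.trans (max_le ?_ ?_)
  · simp only [nthF_zero] at hcap; omega
  · omega

/-- `ppF ∈ FP`. [cite: Cohen1993, §1.7 (power detection runs in polynomial time)] -/
theorem ppF_mem_FP : ppF ∈ FP := by
  refine comp_mem_FP (fanoutFn_mem_FP (notFn_mem_FP (comp_mem_FP isNilFn_mem_FP (comp_mem_FP fstF_mem_FP (sndPow_mem_FP 1))))
    (comp_mem_FP sndF_mem_FP (sndPow_mem_FP 1))) (comp_mem_FP ?_ (fanoutFn_mem_FP idF_mem_FP
    (fanoutFn_mem_FP (comp_mem_FP predF_mem_FP lenBinF_mem_FP) (const_mem_FP _))))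
  refine loopFn_mem_FP ppBody_mem_FP (c := 4) (fun z => ?_) X
  have := length_ppBody_le z; omega

/-- **Value of `ppF`** on `m` with `⟦m⟧ ≥ 1`, `|m| ≥ 1`: the bit "some `k ∈ [2, |m|]` has
`IsPP ⟦m⟧ k`" and, if so, the root for the largest such `k`. [folklore] -/
theorem ppF_apply (m : List Bool) (hm : 1 ≤ bitsToNat m) (hl : 1 ≤ m.length) :
    ppF m = boolPair [decide (∃ k, k ≤ m.length ∧ IsPP (bitsToNat m) k)]
      (if ∃ k, k ≤ m.length ∧ IsPP (bitsToNat m) k then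
        encodeNat (Nat.nthRoot (Nat.findGreatest (IsPP (bitsToNat m)) m.length) (bitsToNat m)) else []) := by
  have hinit : fanoutFn idF (fanoutFn (predF ∘ lenBinF) fun _ => boolPair [] []) m =
      boolPair m (boolPair (encodeNat (m.length - 1)) (ppState none)) := by
    simp [idF, ppState]
  have hloop := iterate_loopStep ppBody m (m.length - 1) m.length (ppState none) (by omega)
  rw [loopModel_ppBody m hm (m.length - 1) none (by omega), ppModel_none, show m.length - 1 + 1 = m.length by omega] at hloop
  simp only [ppF, Function.comp_apply, hinit, fstF_boolPair, eval_X]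
  rw [hloop]
  by_cases hex : ∃ k, k ≤ m.length ∧ IsPP (bitsToNat m) k
  · rw [if_pos hex, if_pos hex]
    have e1 : (isNilFn ∘ fstF ∘ sndPow 1) (boolPair m (boolPair [] (ppState (some (Nat.nthRoot (Nat.findGreatest (IsPP (bitsToNat m)) m.length) (bitsToNat m)))))) = [false] := by
      simp [ppState, isNilFn]
    rw [fanoutFn_apply, notFn_apply e1]
    simp [ppState, hex]
  · rw [if_neg hex, if_neg hex]
    have e1 : (isNilFn ∘ fstF ∘ sndPow 1) (boolPair m (boolPair [] (ppState none))) = [true] := by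
      simp [ppState, isNilFn]
    rw [fanoutFn_apply, notFn_apply e1]
    simp [ppState, hex]

/-- For `v ≥ 2`: a nontrivial perfect-power exponent exists below `size v` iff `Shor1997.ppBase v < v`, and
then `Shor1997.ppBase v` is the root for the largest one. [cite: Cohen1993, §1.7 (power detection: k ≤ lg n)] -/
theorem ppBase_lt_iff {v : ℕ} (hv : 2 ≤ v) :
    (Shor1997.ppBase v < v ↔ ∃ k, k ≤ v.size ∧ IsPP v k) ∧
      (Shor1997.ppBase v < v → Shor1997.ppBase v = Nat.nthRoot (Nat.findGreatest (IsPP v) v.size) v) := by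
  obtain ⟨he0, hepow⟩ := Shor1997.ppExp_spec (m := v) (by omega)
  have hbase := Shor1997.ppBase_eq_nthRoot (m := v) (by omega)
  have hesize := Shor1997.ppExp_le_size v
  -- `2 ≤ ppExp v` iff `Shor1997.ppBase v < v`
  have key : Shor1997.ppBase v < v ↔ 2 ≤ Shor1997.ppExp v := by
    constructor
    · intro hlt
      by_contra h
      have h1 : Shor1997.ppExp v = 1 := by omega
      rw [hbase, h1] at hlt
      simp at hlt
    · intro h2
      rw [hbase]
      set r := Nat.nthRoot (Shor1997.ppExp v) v
      have hr2 : 2 ≤ r := by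
        by_contra hr
        push Not at hr
        have : r ^ Shor1997.ppExp v ≤ 1 := by
          calc r ^ Shor1997.ppExp v ≤ 1 ^ Shor1997.ppExp v := Nat.pow_le_pow_left (by omega) _
            _ = 1 := one_pow _
        omega
      calc r < r ^ 2 := by nlinarith
        _ ≤ r ^ Shor1997.ppExp v := Nat.pow_le_pow_right (by omega) h2
        _ = v := hepow
  have hgreat : 2 ≤ Shor1997.ppExp v → Nat.findGreatest (IsPP v) v.size = Shor1997.ppExp v := by
    intro h2
    rw [Nat.findGreatest_eq_iff]
    refine ⟨hesize, fun _ => ⟨h2, hepow⟩, fun k hk hks hpp => ?_⟩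
    have := Shor1997.le_ppExp (m := v) (k := k) (by omega) hks hpp.2
    omega
  refine ⟨⟨fun hlt => ?_, ?_⟩, fun hlt => ?_⟩
  · have h2 := key.1 hlt
    exact ⟨Shor1997.ppExp v, hesize, h2, hepow⟩
  · rintro ⟨k, hks, hk2, hkpow⟩
    have := Shor1997.le_ppExp (m := v) (k := k) (by omega) hks hkpow
    exact key.2 (by omega)
  · rw [hgreat (key.1 hlt), ← hbase]

/-- **`ppF` computes Shor's perfect-power branch** on a canonical numeral `m = encodeNat v`,
`v ≥ 2`: the bit `Shor1997.ppBase v < v` and then the root `Shor1997.ppBase v`. [cite: Shor1997SICOMP, §5 p.16 (prime powers are handled classically)] -/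
theorem ppF_encodeNat {v : ℕ} (hv : 2 ≤ v) :
    ppF (encodeNat v) = boolPair [decide (Shor1997.ppBase v < v)] (if Shor1997.ppBase v < v then encodeNat (Shor1997.ppBase v) else []) := by
  have hl : (encodeNat v).length = v.size := TM2Pass.length_encodeNat_eq_size v
  have hl1 : 1 ≤ (encodeNat v).length := by rw [hl]; exact Nat.size_pos.2 (by omega)
  rw [ppF_apply (encodeNat v) (by simp; omega) hl1]
  simp only [bitsToNat_encodeNat, hl]
  obtain ⟨hiff, hroot⟩ := ppBase_lt_iff hv
  by_cases h : Shor1997.ppBase v < v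
  · rw [if_pos (hiff.1 h), if_pos h, ← hroot h]
    simp [h, hiff.1 h]
  · have h' : ¬ ∃ k, k ≤ v.size ∧ IsPP v k := fun h' => h (hiff.2 h')
    rw [if_neg h', if_neg h]
    simp [h, h']

/-- The initial loop record of `ppF`. [folklore] -/
def ppInit : List Bool → List Bool := fanoutFn idF (fanoutFn (predF ∘ lenBinF) (fun _ => boolPair [] []))

/-- The flag field of `ppF w`, as computed. [folklore] -/
theorem fstF_ppF (w : List Bool) :
    fstF (ppF w) = notFn (isNilFn ∘ fstF ∘ sndPow 1) ((loopStep ppBody)^[(fstF (ppInit w)).length] (ppInit w)) := by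
  unfold ppF ppInit
  rw [Function.comp_apply, Function.comp_apply, fanoutFn_apply, fstF_boolPair, eval_X]

/-- The flag of `ppF` is one-bit on every input. [folklore] -/
theorem oneBit_fstF_ppF : OneBit (fstF ∘ ppF) := fun w => by
  obtain ⟨b, hb⟩ := (oneBit_notFn (oneBit_isNilFn.comp (fstF ∘ sndPow 1))) ((loopStep ppBody)^[(fstF (ppInit w)).length] (ppInit w))
  exact ⟨b, by rw [Function.comp_apply, fstF_ppF, hb]⟩

/-! ### Two facts about `ppF` on arbitrary strings (for the growth analysis of its user) -/

/-- The base field of `ppF m` is never longer than `m` (it is a capped root). [folklore] -/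
theorem length_sndF_ppF_le (m : List Bool) : (sndF (ppF m)).length ≤ m.length := by
  have key : ∀ z0 : List Bool, fstF z0 = m → sndPow 1 z0 = boolPair [] [] →
      ∀ n : ℕ, (sndF (sndPow 1 ((loopStep ppBody)^[n] z0))).length ≤ m.length := by
    intro z0 hz0f hz0s n
    induction n with
    | zero => simp [hz0s]
    | succ n ih =>
      rw [Function.iterate_succ_apply']
      set y := (loopStep ppBody)^[n] z0 with hy
      have hfy : fstF y = m := by rw [hy, fstF_iterate_loopStep, hz0f]
      obtain ⟨b, hb⟩ := (oneBit_isNilFn.comp (nthF 1)) y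
      cases b
      · rw [loopStep, iteFn_apply_false hb]
        simp only [fanoutFn_apply, sndPow_succ_boolPair, sndPow_zero_boolPair]
        obtain ⟨b1, hb1⟩ := (oneBit_isNilFn.comp (fstF ∘ sndPow 1)) y
        cases b1
        · rw [ppBody, iteFn_apply_false hb1]; exact ih
        · rw [ppBody, iteFn_apply_true hb1]
          have hc1 : OneBit eqF := oneBit_powEqF.comp (fanoutFn (nthF 0) (fanoutFn rF kkF))
          obtain ⟨b2, hb2⟩ := hc1 y
          cases b2
          · rw [iteFn_apply_false hb2]; simp
          · rw [iteFn_apply_true hb2]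
            simp only [fanoutFn_apply, sndF_boolPair]
            have := length_capF_le y
            rw [show nthF 0 y = fstF y from rfl, hfy] at this
            exact this
      · rw [loopStep, iteFn_apply_true hb]
        simp only [fanoutFn_apply, sndPow_succ_boolPair, sndPow_zero_boolPair]
        exact ih
  simp only [ppF, Function.comp_apply, fanoutFn_apply, sndF_boolPair, eval_X, idF, fstF_boolPair]
  exact key _ (by simp) (by simp) _

/-- On a numeral of value `0` the search finds nothing: the capped accumulator started at `1` is
frozen above `0`, so no exponent tests as exact. [folklore] -/
theorem ppBody_apply_zero (m : List Bool) {j : ℕ} (hj : j + 1 ≤ m.length) (hm : bitsToNat m = 0) :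
    ppBody (boolPair m (boolPair (encodeNat j) (ppState none))) = ppState none := by
  simp only [ppState]
  have hkk : kkF (boolPair m (boolPair (encodeNat j) (boolPair [] []))) = encodeNat (j + 1) := by simp [kkF]
  have hr : rF (boolPair m (boolPair (encodeNat j) (boolPair [] []))) = [] := by
    simp only [rF, Function.comp_apply, fanoutFn_apply, nthF_zero, fstF_boolPair, hkk]
    rw [rootF_apply m (by omega) hj, hm, Nat.nthRoot_zero_right (by omega)]; rfl
  have hacc : powAccF (boolPair m (boolPair [] (encodeNat (j + 1)))) = [true] := by
    rw [powAccF_apply m [] (k := j + 1) hj, hm]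
    simp only [bitsToNat_nil]
    rw [accModel, if_pos (by omega), accModel_of_lt _ _ (by omega)]; rfl
  have he : eqF (boolPair m (boolPair (encodeNat j) (boolPair [] []))) = [false] := by
    simp only [eqF, Function.comp_apply, fanoutFn_apply, nthF_zero, fstF_boolPair, hkk, hr]
    have hle : powLeF (boolPair m (boolPair [] (encodeNat (j + 1)))) = [false] := by
      rw [powLeF, notFn_apply (b := true)]
      · rfl
      · simp [hacc, hm]
    rw [powEqF, andFn]
    rw [iteFn_apply_false hle]
  rw [ppBody, iteFn_apply_true (by simp [isNilFn]), iteFn_apply_false he]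
  simp

/-- The loop model on a numeral of value `0` stays at "nothing found". [folklore] -/
theorem loopModel_ppBody_zero (m : List Bool) (hm : bitsToNat m = 0) :
    ∀ c : ℕ, c + 1 ≤ m.length → loopModel ppBody m c (ppState none) = ppState none
  | 0, _ => by simp [loopModel]
  | c + 1, hc => by rw [loopModel, ppBody_apply_zero m hc hm, loopModel_ppBody_zero m hm c (by omega)]

/-- **When `ppF` reports a perfect power, its base field is a genuine root** `r` with `r ^ k = ⟦m⟧`
for some `k ≥ 2` — on every string `m`. [folklore] -/
theorem ppF_root_of_flag (m : List Bool) (h : fstF (ppF m) = [true]) :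
    ∃ r k : ℕ, 2 ≤ k ∧ r ^ k = bitsToNat m ∧ sndF (ppF m) = encodeNat r := by
  rcases Nat.eq_zero_or_pos m.length with h0 | hl
  · -- the empty string: no rounds, nothing found
    have hm : m = [] := List.eq_nil_of_length_eq_zero h0
    subst hm
    exfalso
    have e : ppF [] = boolPair [false] [] := by
      simp only [ppF, Function.comp_apply, fanoutFn_apply, idF, fstF_boolPair, eval_X, List.length_nil, Function.iterate_zero, id]
      rw [notFn_apply (b := true) (by simp [isNilFn])]
      simp
    rw [e, fstF_boolPair] at h
    simp at h
  · rcases Nat.eq_zero_or_pos (bitsToNat m) with hv | hv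
    · -- value `0`: the search finds nothing
      exfalso
      have hinit : fanoutFn idF (fanoutFn (predF ∘ lenBinF) fun _ => boolPair [] []) m =
          boolPair m (boolPair (encodeNat (m.length - 1)) (ppState none)) := by simp [idF, ppState]
      have hloop := iterate_loopStep ppBody m (m.length - 1) m.length (ppState none) (by omega)
      rw [loopModel_ppBody_zero m hv (m.length - 1) (by omega)] at hloop
      have e : ppF m = boolPair [false] [] := by
        simp only [ppF, Function.comp_apply, hinit, fstF_boolPair, eval_X]
        rw [hloop, fanoutFn_apply, notFn_apply (b := true) (by simp [ppState, isNilFn])]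
        simp [ppState]
      rw [e, fstF_boolPair] at h
      simp at h
    · rw [ppF_apply m hv hl] at h ⊢
      rw [fstF_boolPair] at h
      have hex : ∃ k, k ≤ m.length ∧ IsPP (bitsToNat m) k := by
        by_contra hne; simp [hne] at h
      obtain ⟨k, hk, hpp⟩ := hex
      have hspec : IsPP (bitsToNat m) (Nat.findGreatest (IsPP (bitsToNat m)) m.length) :=
        Nat.findGreatest_spec hk hpp
      refine ⟨Nat.nthRoot (Nat.findGreatest (IsPP (bitsToNat m)) m.length) (bitsToNat m), _, hspec.1, hspec.2, ?_⟩
      rw [sndF_boolPair, if_pos ⟨k, hk, hpp⟩]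

end ShorFP

end Literature.Computability.Cryptography

end
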